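import Summits.HodgeConjecture.HodgeConjecture.Theorems.Ring2HypothesesDescentAbsoluteHalving
import Literature.AlgebraicGeometry.HodgeTheory.AbsoluteHodgeSplitting
import HarnessLib

/-!
# Ring 2 — hypotheses layer, descent axis: row b06 halved, II — in the per-variety words of Charles–Schnell 11.2.18,
# and the two moduli compared (Main Theorem 2.11 ⟹ the instance of Example 2.1 (c) used on abelian varieties)

HONEST FRAMING (page 1, verbatim the cell's standing line): **research route conditional on HC_CM; not a
corollary; Q11.4-sentence-2 already refuted in dim ≥ 3.** Nothing in this file proves a case of the Hodge conjecture;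
nothing discharges the binder of record b06 `Ring2.Hypotheses.AbsoluteHodgeImpliesAlgebraicAV` (OPEN, `≡ HC_AV` modulo
fact c1); the binder table's numbers do not move. `HC_CM` (`Theses.RankFourFaces.CMAbelianHodge`) does not occur in this
file; `HC_AV` is not asserted. Companion of `Ring2HypothesesDescentAbsoluteHalving` (seat `ring2-b06`, gen 68), which halves
row b06 and the general row `AbsoluteHodgeImpliesAlgebraic` modulo the named fact (c) `deligne1982_lefschetz_absoluteHodge_iff`
(Deligne 1982, Ex. 2.1 (c); lane `lit-hodgefound`, count once THEIRS).

* §4 **The rows in the lane's per-variety vocabulary** `AbsoluteHodgeClassesAreAlgebraicFor n X` ("the absolute Hodge classes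
  of `X` are algebraic" = Charles–Schnell 11.2.18 for `X`, `AbsoluteHodgeSplitting.lean`, lane `lit-hodgefound`): row b06
  `↔ ∀ A, AbsoluteHodgeClassesAreAlgebraicFor A.dim A.X` and the general row `↔ ∀ X smooth projective, AbsoluteHodgeClassesAreAlgebraicFor n X`
  (fact-free bookkeeping); per abelian variety, 11.2.18 for `A` is its lower half and its upper half (modulo (c)); the `ℚ̄`
  row `AbsoluteHodgeImpliesAlgebraicQbar` is its lower half (modulo (c)), hence the general row ≡ the lower half over `ℚ̄`
  (modulo (c) + Voisin's c7, `absoluteHodgeImpliesAlgebraic_iff_qbar_lowerHalf_of_voisin`).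
* §5 **THE MODULI ARE NESTED ON ABELIAN VARIETIES**: granted Deligne's Main Theorem 2.11 instead (fact c1
  `deligne1982_hodgeClasses_abelianVariety_absoluteHodge`, hypothesis `hD`), the instance of (c) that the companion file uses
  on an abelian variety — for the hyperplane class of the tree's hard Lefschetz datum — HOLDS
  (`isAbsoluteHodgeClass_iff_L_abelian_of_deligne`: on `A` absolute Hodge = rational `(p,p)`, and `Lʲ` preserves and detects
  rational classes and Hodge types in the hard Lefschetz range, `HardLefschetzNFold.isRationalClass_L_iff`,
  `….isOfHodgeType_L_iff`); the transfer (T↓) modulo c1 (`absoluteHodge_algebraic_abelian_of_lower_of_deligne`); and row b06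
  is its lower half modulo c1 as well (`absoluteHodgeImpliesAlgebraicAV_iff_lowerHalf_of_deligne`) — literally the rung
  file's `absoluteHodgeImpliesAlgebraicAV_iff_deepMiddle_of_deligne` READ ON ABSOLUTE CLASSES. So on abelian varieties (c)
  is no assumption beyond c1; what (c) buys is the companion's §1–§2 (arbitrary smooth projective `X`) and the intrinsic
  form of its §3.

HONEST COLUMN. Nothing is discharged; every theorem is an equivalence between OPEN statements, an implication with an
undischarged hypothesis, or carries c1 / (c) as a hypothesis. No new definition, no new named fact.

References (bib keys): Deligne1982HodgeCycles (§2 Ex. 2.1 (c) p. 16, Main Thm. 2.11 p. 19), CharlesSchnell2014Notes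
(Def. 11.2.3, §11.2.5 Conj. 11.2.17–11.2.18), VoisinHodgeI2002 (Thm. 6.25, Rem. 6.27, §7.1.2), Lieberman1968 (main
theorem), KerrPearlstein2011 (§3.1), Voisin2007HodgeLoci (Prop. 1.2, Rem. 1.4). -/

noncomputable section

set_option linter.dupNamespace false

open CategoryTheory AlgebraicGeometry
open Literature.AlgebraicTopology.SingularHomology Literature.Geometry.Kaehler
open Literature.AlgebraicGeometry Literature.AlgebraicGeometry.Motives
open Literature.AlgebraicGeometry.HodgeTheory

namespace Summit.HodgeConjecture.HodgeConjecture.Ring2.Hypotheses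

/-! ## §4 The rows in the per-variety vocabulary of Charles–Schnell 11.2.18 (`AbsoluteHodgeClassesAreAlgebraicFor`) -/

section PerVariety

/-- **Row b06 ≡ "11.2.18 holds for every complex abelian variety"** in the lane's per-variety predicate
`AbsoluteHodgeClassesAreAlgebraicFor` (`AbsoluteHodgeSplitting.lean`; its Hodge-model conjunct is the tree's theorem
`nonempty_hodgeModel_holds`). Fact-free bookkeeping; neither side is asserted. [cite: CharlesSchnell2014Notes, §11.2.5 Conj. 11.2.18] -/
theorem absoluteHodgeImpliesAlgebraicAV_iff_forall_absoluteHodgeClassesAreAlgebraicFor :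
    AbsoluteHodgeImpliesAlgebraicAV ↔ ∀ A : AbelianVariety ℂ, AbsoluteHodgeClassesAreAlgebraicFor A.dim A.X :=
  ⟨fun h A ↦ (absoluteHodgeClassesAreAlgebraicFor_iff_of_isSmoothProjective
      (AbelianVariety.isSmoothProjective_holds (A := A))).2 (h A),
    fun h A p c hc ↦ (h A).2 p c hc⟩

/-- **The general row ≡ "11.2.18 holds for every smooth projective complex variety"**. Fact-free bookkeeping; neither side
is asserted. [cite: CharlesSchnell2014Notes, §11.2.5 Conj. 11.2.18] -/
theorem absoluteHodgeImpliesAlgebraic_iff_forall_absoluteHodgeClassesAreAlgebraicFor :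
    AbsoluteHodgeImpliesAlgebraic ↔
      ∀ ⦃n : ℕ⦄ ⦃X : SchemeOver ℂ⦄, IsSmoothProjective n X → AbsoluteHodgeClassesAreAlgebraicFor n X :=
  ⟨fun h _ _ hX ↦ (absoluteHodgeClassesAreAlgebraicFor_iff_of_isSmoothProjective hX).2 (h hX),
    fun h _ _ hX p c hc ↦ (h hX).2 p c hc⟩

/-- **11.2.18 for ONE abelian variety is its lower half** (modulo (c)): `AbsoluteHodgeClassesAreAlgebraicFor dim A A` iff the
absolute Hodge classes of codimension `2 ≤ p ≤ dim A / 2` on `A` are algebraic. [cite: CharlesSchnell2014Notes, §11.2.5 Conj. 11.2.18]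
[cite: Deligne1982HodgeCycles, §2 Example 2.1 (c) (p. 16)] -/
theorem absoluteHodgeClassesAreAlgebraicFor_abelian_iff_lowerHalf (h21c : deligne1982_lefschetz_absoluteHodge_iff)
    (A : AbelianVariety ℂ) :
    AbsoluteHodgeClassesAreAlgebraicFor A.dim A.X ↔
      ∀ p : ℕ, 2 ≤ p → 2 * p ≤ A.dim →
        ∀ c : complexBetti A.X (2 * p), IsAbsoluteHodgeClass A.dim A.X p c → c ∈ algebraicClasses A.X p := by
  rw [absoluteHodgeClassesAreAlgebraicFor_iff_of_isSmoothProjective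
    (AbelianVariety.isSmoothProjective_holds (A := A))]
  exact ⟨fun h p _ _ c hc ↦ h p c hc,
    fun h p c hc ↦ forall_absoluteHodge_algebraic_abelian_of_lowerHalf h21c A h p c hc⟩

/-- **11.2.18 for ONE abelian variety is its upper half** (modulo (c); Lieberman): `AbsoluteHodgeClassesAreAlgebraicFor dim A A`
iff the absolute Hodge classes of codimension `p`, `dim A ≤ 2p ≤ 2 dim A − 4`, on `A` are algebraic.
[cite: CharlesSchnell2014Notes, §11.2.5 Conj. 11.2.18] [cite: Lieberman1968, main theorem] -/
theorem absoluteHodgeClassesAreAlgebraicFor_abelian_iff_upperHalf (h21c : deligne1982_lefschetz_absoluteHodge_iff)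
    (A : AbelianVariety ℂ) :
    AbsoluteHodgeClassesAreAlgebraicFor A.dim A.X ↔
      ∀ p : ℕ, A.dim ≤ 2 * p → p + 2 ≤ A.dim →
        ∀ c : complexBetti A.X (2 * p), IsAbsoluteHodgeClass A.dim A.X p c → c ∈ algebraicClasses A.X p := by
  rw [absoluteHodgeClassesAreAlgebraicFor_iff_of_isSmoothProjective
    (AbelianVariety.isSmoothProjective_holds (A := A))]
  exact ⟨fun h p _ _ c hc ↦ h p c hc,
    fun h p c hc ↦ forall_absoluteHodge_algebraic_abelian_of_upperHalf h21c A h p c hc⟩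

/-- **The `ℚ̄` row is its lower half** (modulo (c)): `AbsoluteHodgeImpliesAlgebraicQbar` — absolute Hodge classes are algebraic
on smooth projective varieties defined over `ℚ̄` (`Ring2HypothesesDescent`, verbatim the hypothesis of Voisin's c7) — holds iff
it holds in codimensions `2 ≤ p ≤ n/2` (the per-variety halving `forall_absoluteHodge_algebraic_of_lowerHalf` applied to
`X₀ ×_ι ℂ`). Neither side is asserted. [cite: Deligne1982HodgeCycles, §2 Example 2.1 (c) (p. 16)] [cite: Voisin2007HodgeLoci, Prop. 1.2 and Rem. 1.4] -/
theorem absoluteHodgeImpliesAlgebraicQbar_iff_lowerHalf (h21c : deligne1982_lefschetz_absoluteHodge_iff) :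
    AbsoluteHodgeImpliesAlgebraicQbar ↔
      ∀ ι : AlgebraicClosure ℚ →+* ℂ, ∀ ⦃n : ℕ⦄ ⦃X₀ : SchemeOver (AlgebraicClosure ℚ)⦄,
        IsSmoothProjective n ((baseChangeHom ι).obj X₀) → ∀ p : ℕ, 2 ≤ p → 2 * p ≤ n →
          ∀ c : complexBetti ((baseChangeHom ι).obj X₀) (2 * p),
            IsAbsoluteHodgeClass n ((baseChangeHom ι).obj X₀) p c →
              c ∈ algebraicClasses ((baseChangeHom ι).obj X₀) p :=
  ⟨fun h ι _ _ hX p _ _ c hc ↦ h ι hX p c hc,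
    fun h ι _ _ hX p c hc ↦ forall_absoluteHodge_algebraic_of_lowerHalf h21c hX (h ι hX) p c hc⟩

/-- **The general row ≡ the LOWER HALF OVER `ℚ̄`** (modulo (c) and Voisin's c7 `voisin2007_hodgeConjecture_absolute_of_qbar`):
"absolute Hodge classes are algebraic on every smooth projective complex variety" holds iff every absolute Hodge class of
codimension `2 ≤ p ≤ n/2` on every smooth projective `X₀ ×_ι ℂ`, `X₀/ℚ̄`, is algebraic — Voisin's reduction to `ℚ̄`
(`absoluteHodgeImpliesAlgebraic_of_qbar_of_voisin`) composed with the halving. Neither side is asserted.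
[cite: Voisin2007HodgeLoci, Prop. 1.2 and Rem. 1.4] [cite: Deligne1982HodgeCycles, §2 Example 2.1 (c) (p. 16)] -/
theorem absoluteHodgeImpliesAlgebraic_iff_qbar_lowerHalf_of_voisin
    (hV : voisin2007_hodgeConjecture_absolute_of_qbar) (h21c : deligne1982_lefschetz_absoluteHodge_iff) :
    AbsoluteHodgeImpliesAlgebraic ↔
      ∀ ι : AlgebraicClosure ℚ →+* ℂ, ∀ ⦃n : ℕ⦄ ⦃X₀ : SchemeOver (AlgebraicClosure ℚ)⦄,
        IsSmoothProjective n ((baseChangeHom ι).obj X₀) → ∀ p : ℕ, 2 ≤ p → 2 * p ≤ n →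
          ∀ c : complexBetti ((baseChangeHom ι).obj X₀) (2 * p),
            IsAbsoluteHodgeClass n ((baseChangeHom ι).obj X₀) p c →
              c ∈ algebraicClasses ((baseChangeHom ι).obj X₀) p :=
  ⟨fun h _ _ _ hX p _ _ c hc ↦ h hX p c hc,
    fun h ↦ absoluteHodgeImpliesAlgebraic_of_qbar_of_voisin hV
      ((absoluteHodgeImpliesAlgebraicQbar_iff_lowerHalf h21c).2 h)⟩

end PerVariety

/-! ## §5 The moduli compared: on abelian varieties, Main Theorem 2.11 (c1) already gives the instance of (c) used in §3 -/

section Moduli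

/-- **Granted Deligne's Main Theorem 2.11 (fact c1), the instance of Ex. 2.1 (c) used in §3 HOLDS**: on a complex abelian
variety `A` with hard Lefschetz datum `Λ`, for `2p + j = dim A` and `x ∈ H^{2p}(A(ℂ); ℂ)`, `x` is absolute Hodge iff
`Lʲ x ∈ H^{2(p+j)}` is — because on `A` "absolute Hodge" = "rational of type `(p,p)`" (c1 one way, Def. 11.2.3 with `σ = id`
the other) and `Lʲ` preserves and detects rational classes and Hodge types in the hard Lefschetz range
(`HardLefschetzNFold.isRationalClass_L_iff`, `….isOfHodgeType_L_iff`). So on abelian varieties (c) is no assumption beyond c1.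
[cite: Deligne1982HodgeCycles, Main Thm. 2.11 (p. 19) and §2 Example 2.1 (c) (p. 16)] [cite: VoisinHodgeI2002, Thm. 6.25, Rem. 6.27 and §7.1.2] -/
theorem isAbsoluteHodgeClass_iff_L_abelian_of_deligne
    (hD : deligne1982_hodgeClasses_abelianVariety_absoluteHodge) (A : AbelianVariety ℂ)
    (Λ : HardLefschetzNFold A.dim A.X) {p j q : ℕ} (hj : 2 * p + j = A.dim) (hq : p + j = q)
    (x : complexBetti A.X (2 * p)) :
    IsAbsoluteHodgeClass A.dim A.X p x ↔
      IsAbsoluteHodgeClass A.dim A.X q (Λ.L j (2 * p) (2 * q) (by omega) x) := by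
  subst hq
  constructor
  · intro hx
    refine hD A (p + j) _ (Λ.isRationalClass_L j (2 * p) _ _ hx.isRationalClass) ?_
    exact Λ.isOfHodgeType_L j (2 * p) _ _ p p hx.isOfHodgeType
  · intro hy
    refine hD A p x ((Λ.isRationalClass_L_iff hj _ _ x).1 hy.isRationalClass) ?_
    exact (Λ.isOfHodgeType_L_iff hj _ _ p p x).1 hy.isOfHodgeType

/-- **(T↓) on an abelian variety modulo c1 instead of (c)**: for `2p + j = dim A`, `q = p + j`, codimension-`p` algebraicity of
absolute Hodge classes gives codimension-`q` algebraicity — every absolute Hodge `y ∈ H^{2q}` is `Lʲ x` with `x` rational of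
type `(p,p)` (`HardLefschetzNFold.exists_hdg_preimage`), `x` is absolute Hodge by c1, algebraic by hypothesis, and `Lʲ x` is
algebraic. [cite: Deligne1982HodgeCycles, Main Thm. 2.11 (p. 19)] [cite: VoisinHodgeI2002, Thm. 6.25, Rem. 6.27 and §7.1.2] -/
theorem absoluteHodge_algebraic_abelian_of_lower_of_deligne
    (hD : deligne1982_hodgeClasses_abelianVariety_absoluteHodge) (A : AbelianVariety ℂ) {p j q : ℕ}
    (hj : 2 * p + j = A.dim) (hq : p + j = q)
    (hlow : ∀ c : complexBetti A.X (2 * p), IsAbsoluteHodgeClass A.dim A.X p c → c ∈ algebraicClasses A.X p)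
    (y : complexBetti A.X (2 * q)) (hy : IsAbsoluteHodgeClass A.dim A.X q y) : y ∈ algebraicClasses A.X q := by
  subst hq
  have hA : IsSmoothProjective A.dim A.X := AbelianVariety.isSmoothProjective_holds (A := A)
  obtain ⟨Λ⟩ := nonempty_hardLefschetzNFold_holds A.dim A.X hA
  exact Λ.mem_algebraicClasses_of_index (l := p) (j := j) (by omega) rfl
    (fun c' hc' hpp' ↦ hlow c' (hD A p c' hc' hpp')) y hy.isRationalClass hy.isOfHodgeType

/-- **Row b06 is its lower half modulo c1 as well** — the rung file's `absoluteHodgeImpliesAlgebraicAV_iff_deepMiddle_of_deligne`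
READ ON ABSOLUTE CLASSES (under c1 the deep-middle Hodge classes of an abelian variety are exactly its deep-middle absolute
Hodge classes). Recorded to make the comparison of §3 with the rung file literal. Row b06 is NOT asserted.
[cite: Deligne1982HodgeCycles, Main Thm. 2.11 (p. 19)] [cite: KerrPearlstein2011, §3.1] -/
theorem absoluteHodgeImpliesAlgebraicAV_iff_lowerHalf_of_deligne
    (hD : deligne1982_hodgeClasses_abelianVariety_absoluteHodge) :
    AbsoluteHodgeImpliesAlgebraicAV ↔
      ∀ (A : AbelianVariety ℂ) (p : ℕ), 2 ≤ p → 2 * p ≤ A.dim →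
        ∀ c : complexBetti A.X (2 * p), IsAbsoluteHodgeClass A.dim A.X p c → c ∈ algebraicClasses A.X p := by
  rw [absoluteHodgeImpliesAlgebraicAV_iff_deepMiddle_of_deligne hD]
  refine ⟨fun h A p hp h2 c hc ↦ h A p hp h2 c hc.isRationalClass hc.isOfHodgeType,
    fun h A p hp h2 c hc hpp ↦ h A p hp h2 c (hD A p c hc hpp)⟩

end Moduli
/-! ## Audit: nothing is decided here

No theorem above concludes `AbsoluteHodgeImpliesAlgebraicAV`, `AbsoluteHodgeImpliesAlgebraic`, `HC_AV` or `HC_CM`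
outright; the named facts (c) `deligne1982_lefschetz_absoluteHodge_iff` and c1
`deligne1982_hodgeClasses_abelianVariety_absoluteHodge` occur only as hypotheses. Axiom closures: the three standard axioms. -/

#print axioms Summit.HodgeConjecture.HodgeConjecture.Ring2.Hypotheses.absoluteHodgeImpliesAlgebraicAV_iff_forall_absoluteHodgeClassesAreAlgebraicFor
#print axioms Summit.HodgeConjecture.HodgeConjecture.Ring2.Hypotheses.isAbsoluteHodgeClass_iff_L_abelian_of_deligne
#print axioms Summit.HodgeConjecture.HodgeConjecture.Ring2.Hypotheses.absoluteHodgeImpliesAlgebraicAV_iff_lowerHalf_of_deligne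

end Summit.HodgeConjecture.HodgeConjecture.Ring2.Hypotheses

end
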